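import Mathlib.AlgebraicTopology.FundamentalGroupoid.FundamentalGroup
import Mathlib.AlgebraicTopology.FundamentalGroupoid.SimplyConnected
import Mathlib.GroupTheory.Finiteness
import Mathlib.Topology.Subpath
import Mathlib.Topology.UnitInterval
import Literature.Topology.FourManifolds.SphereSimplyConnected
import HarnessLib

/-!
# Finite generation of the fundamental group from a finite open cover

This file proves the *generation half* of the Seifert–van Kampen theorem in the weak form needed
to show that fundamental groups of reasonable compact spaces (and of knot complements) are finitely
generated:

**Theorem** (`Literature.AlgebraicTopology.FundamentalGroup.fundamentalGroup_fg_of_finite_cover`). Let `X` be a topological space covered by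
finitely many path-connected open sets `V i` such that, whenever `V i ∩ V j ≠ ∅` (in particular for
`i = j`), every loop lying in `V i ∪ V j` is null-homotopic in `X`. Then `π₁(X, x₀)` is finitely
generated for every base point `x₀`.

The proof is the classical Lebesgue-number argument (e.g. the proof that `π₁` of a compact manifold
is finitely generated, or the first half of the proof of van Kampen's theorem, Hatcher,
*Algebraic Topology*, Lemma 1.15 / Thm. 1.20; Lee, *Introduction to Topological Manifolds*,
proof of Thm. 10.1): choose points `v i ∈ V i`, points `q i j ∈ V i ∩ V j`, paths `a i j` from
`v i` to `q i j` inside `V i` and `b i j` from `q i j` to `v j` inside `V j`, paths `g i` from `x₀` to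
`v i` (when they exist) and, when `x₀ ∈ V i`, a path `e i` from `v i` to `x₀` inside `V i`. Then the
finitely many classes `α i j = [g i · a i j · b i j · (g j)⁻¹]` and `β i = [g i · e i]` generate:
subdivide a loop `γ` at `x₀` into pieces `γ_k = γ.subpath t_k t_(k+1) ⊆ V (i_k)` (Lebesgue number,
Mathlib's `exists_monotone_Icc_subset_open_cover_unitInterval`, and Mathlib's `Path.subpath`,
`Path.Homotopy.subpathTransSubpath`) and prove by induction on `k` that the class of
`γ.subpath 0 t_k` lies in `H · [g (i_k)] · [h]` for every path `h` from `v (i_k)` to `γ t_k` inside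
`V (i_k)`, `H` the subgroup generated by the `α`'s and `β`'s; the induction step replaces the path
`h' · γ_k · h⁻¹` from `v i` to `v j` inside `V i ∪ V j` by `a i j · b i j`, the two being homotopic
because the loop they form lies in `V i ∪ V j` (`Literature.Topology.FourManifolds.Path.Homotopic.of_trans_symm` from
`Literature.Topology.FourManifolds.SphereSimplyConnected`).

No hypothesis of compactness, metrisability or path-connectedness of `X` is needed (only the loop is
subdivided; pieces `V i` not reachable from `x₀` never occur along a loop at `x₀`).

## Main statements

* `Literature.AlgebraicTopology.FundamentalGroup.homotopic_refl_of_range_subset`: a loop inside a simply connected subset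
  (`IsSimplyConnected`) is null-homotopic; `Literature.AlgebraicTopology.FundamentalGroup.isSimplyConnected_preimage_val`: transport of
  simple connectivity of `R ⊆ U` to the subtype `U`;
* `Literature.AlgebraicTopology.FundamentalGroup.fundamentalGroup_fg_of_finite_cover`: the theorem above;
* `Literature.AlgebraicTopology.FundamentalGroup.fundamentalGroup_fg_of_finite_cover_of_isSimplyConnected`: the subspace form with simply
  connected containers (for an open subset `U ⊆ Y` covered by open path-connected `W i ⊆ U`).

Related: `Path.Homotopic.refl_of_isOpen_cover` in
`Literature/AlgebraicTopology/FundamentalGroup/SphereSimplyConnected.lean` is the same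
Lebesgue-number argument in its *trivial-`π₁`* form (Hatcher's Lemma 1.15: simply connected pieces
with path-connected intersections give a simply connected union); the present file is the
*finite-generation* form.

## Sources

A. Hatcher, *Algebraic Topology* (2002), §1.2 (Lemma 1.15 and the proof of Thm. 1.20);
J. M. Lee, *Introduction to Topological Manifolds*, 2nd ed. (2011), Ch. 7, Ch. 10. The statement in
the present generality is folklore. Mathlib has the fundamental group(oid)
(`FundamentalGroup`, `Path.Homotopic.Quotient`), simply connected and contractible spaces,
subpaths (`Path.subpath`, `Mathlib.Topology.Subpath`) and the Lebesgue partition lemma, but no form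
of the Seifert–van Kampen theorem for fundamental groups (searched `vanKampen`, `VanKampen`,
`Group.FG (FundamentalGroup`).
-/

noncomputable section

open Set Function Topology unitInterval

namespace Literature.AlgebraicTopology.FundamentalGroup

variable {X : Type*} [TopologicalSpace X]

/-! ## Loops in simply connected subsets -/

/-- **A loop lying in a simply connected subset is null-homotopic** in the ambient space (Mathlib's
`isSimplyConnected_iff_exists_homotopy_refl_forall_mem` even provides a null-homotopy inside the
subset). In particular this applies to subsets that are contractible as subspaces
(`IsSimplyConnected S` is `SimplyConnectedSpace S`, an instance consequence of
`ContractibleSpace S`). [folklore] -/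
theorem homotopic_refl_of_range_subset {S : Set X} (hS : IsSimplyConnected S) {y : X}
    (γ : Path y y) (h : range γ ⊆ S) : γ.Homotopic (Path.refl y) := by
  obtain ⟨F, -⟩ := (isSimplyConnected_iff_exists_homotopy_refl_forall_mem.1 hS).2 y γ
    fun t => h (mem_range_self t)
  exact ⟨F⟩

/-- Simple connectivity of a subset `R ⊆ U` of `Y` is the same whether `R` is viewed in `Y` or in
the subtype `U` (the inclusion `U → Y` is an embedding, `IsEmbedding.isSimplyConnected_image`).
[folklore] -/
theorem isSimplyConnected_preimage_val {Y : Type*} [TopologicalSpace Y] {U R : Set Y} (hRU : R ⊆ U)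
    (hR : IsSimplyConnected R) : IsSimplyConnected (((↑) : U → Y) ⁻¹' R) := by
  rw [← IsEmbedding.subtypeVal.isSimplyConnected_image, Subtype.image_preimage_coe,
    inter_eq_right.2 hRU]
  exact hR

/-- In a subtype `U ⊆ Y`, a loop whose image lies in `(↑)⁻¹' R` for a simply connected `R ⊆ U` is
null-homotopic in `U`. [folklore] -/
theorem homotopic_refl_of_range_subset_preimage_val {Y : Type*} [TopologicalSpace Y] {U R : Set Y}
    (hRU : R ⊆ U) (hR : IsSimplyConnected R) {y : U} (γ : Path y y)
    (h : range γ ⊆ ((↑) : U → Y) ⁻¹' R) : γ.Homotopic (Path.refl y) :=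
  homotopic_refl_of_range_subset (isSimplyConnected_preimage_val hRU hR) γ h

/-! ## The generation theorem -/

/-- **The fundamental group is finitely generated when the space has a finite cover by
path-connected open sets whose pairwise unions (of intersecting members) carry only loops that are
null-homotopic in the space** (generation half of the Seifert–van Kampen theorem, Lebesgue-number
argument; Hatcher, *Algebraic Topology*, Lemma 1.15 and proof of Thm. 1.20). Precisely: if
`X = ⋃ i, V i` with `ι` finite, each `V i` open and path connected, and for all `i, j` with
`V i ∩ V j ≠ ∅` every loop with image in `V i ∪ V j` is homotopic to the constant loop in `X`, then
`π₁(X, x₀)` is finitely generated for every `x₀`. The generators are the classes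
`[g i · a i j · b i j · (g j)⁻¹]` and `[g i · e i]` described in the module docstring. Real proof.
[folklore] -/
theorem fundamentalGroup_fg_of_finite_cover {ι : Type*} [Finite ι] (V : ι → Set X)
    (hVo : ∀ i, IsOpen (V i)) (hVc : ∀ i, IsPathConnected (V i)) (hcov : ⋃ i, V i = univ)
    (hnull : ∀ i j, (V i ∩ V j).Nonempty →
      ∀ ⦃y : X⦄ (γ : Path y y), range γ ⊆ V i ∪ V j → γ.Homotopic (Path.refl y))
    (x₀ : X) : Group.FG (FundamentalGroup X x₀) := by
  classical
  -- (0) cancellation `γ⁻¹ · (γ · δ) = δ` for path classes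
  have cancel : ∀ {a b c : X} (γ : Path.Homotopic.Quotient a b) (δ : Path.Homotopic.Quotient b c),
      γ.symm.trans (γ.trans δ) = δ := fun γ δ => by
    rw [← Path.Homotopic.Quotient.trans_assoc, Path.Homotopic.Quotient.symm_trans,
      Path.Homotopic.Quotient.refl_trans]
  -- (1) chosen points and chosen paths inside the pieces
  choose v hv using fun i => (hVc i).nonempty
  have pin : ∀ i, ∀ a ∈ V i, ∀ b ∈ V i, ∃ p : Path a b, range p ⊆ V i := fun i a ha b hb =>
    ⟨((hVc i).joinedIn a ha b hb).somePath,
      range_subset_iff.2 ((hVc i).joinedIn a ha b hb).somePath_mem⟩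
  choose pth hpth using pin
  have hq' : ∀ p : ι × ι, ∃ q : X, (V p.1 ∩ V p.2).Nonempty → q ∈ V p.1 ∩ V p.2 := fun p => by
    by_cases h : (V p.1 ∩ V p.2).Nonempty
    · exact ⟨h.some, fun _ => h.some_mem⟩
    · exact ⟨v p.1, fun h' => absurd h' h⟩
  choose q hq using hq'
  -- (2) the finitely many generators
  let α : ι × ι → FundamentalGroup X x₀ := fun p =>
    if h : (V p.1 ∩ V p.2).Nonempty ∧ Joined x₀ (v p.1) ∧ Joined x₀ (v p.2) then
      FundamentalGroup.fromPath (Path.Homotopic.Quotient.mk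
        ((h.2.1.somePath.trans ((pth p.1 (v p.1) (hv p.1) (q p) (hq p h.1).1).trans
          (pth p.2 (q p) (hq p h.1).2 (v p.2) (hv p.2)))).trans h.2.2.somePath.symm))
    else 1
  let β : ι → FundamentalGroup X x₀ := fun i =>
    if h : x₀ ∈ V i then
      FundamentalGroup.fromPath (Path.Homotopic.Quotient.mk
        ((Joined.somePath ⟨(pth i (v i) (hv i) x₀ h).symm⟩).trans (pth i (v i) (hv i) x₀ h)))
    else 1
  let H : Subgroup (FundamentalGroup X x₀) := Subgroup.closure (range α ∪ range β)
  have hαH : ∀ p, α p ∈ H := fun p => Subgroup.subset_closure (Or.inl ⟨p, rfl⟩)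
  have hβH : ∀ i, β i ∈ H := fun i => Subgroup.subset_closure (Or.inr ⟨i, rfl⟩)
  -- (3) it suffices that the class of every loop lies in `H`
  suffices key : ∀ γ : Path x₀ x₀, FundamentalGroup.fromPath (Path.Homotopic.Quotient.mk γ) ∈ H by
    refine Group.fg_iff.2 ⟨range α ∪ range β, ?_, (finite_range α).union (finite_range β)⟩
    rw [eq_top_iff]
    rintro g -
    obtain ⟨γ, hγ⟩ := Path.Homotopic.Quotient.mk_surjective (FundamentalGroup.toPath g)
    rw [show g = FundamentalGroup.fromPath (Path.Homotopic.Quotient.mk γ) from hγ.symm]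
    exact key γ
  intro γ
  have hx : x₀ = γ 0 := γ.source.symm
  -- the whole loop and the empty prefix as subpaths (Mathlib `Path.subpath_zero_one/_self`)
  have e01 : (γ.subpath 0 1).cast hx γ.target.symm = γ := by
    ext u
    rw [Path.cast_coe, Path.subpath_zero_one, Path.cast_coe]
  have e00 : (γ.subpath 0 0).cast hx hx = Path.refl x₀ := by
    ext u
    rw [Path.cast_coe, Path.subpath_self, Path.refl_apply, Path.refl_apply, ← hx]
  -- (4) Lebesgue partition of the loop subordinate to the cover
  obtain ⟨t, ht0, htm, ⟨N, hN⟩, hsub⟩ :=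
    exists_monotone_Icc_subset_open_cover_unitInterval (c := fun i => γ ⁻¹' V i)
      (fun i => (hVo i).preimage γ.continuous)
      (by
        intro s _
        have hs : γ s ∈ ⋃ i, V i := by rw [hcov]; exact mem_univ _
        simpa only [mem_iUnion, mem_preimage] using hs)
  choose idx hidx using hsub
  -- (5) the inductive claim: the class of `γ.subpath 0 s`, `γ s = y ∈ V i`, lies in
  -- `H · [g i] · [h]` for every path `h` from `v i` to `y` inside `V i` (`g i = J.somePath`)
  let P : I → ι → Prop := fun s i => ∀ (y : X) (hy : γ s = y), y ∈ V i →
    ∀ (J : Joined x₀ (v i)) (h : Path (v i) y), range h ⊆ V i →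
      ∃ w ∈ H, Path.Homotopic.Quotient.mk ((γ.subpath 0 s).cast hx hy.symm) =
        (FundamentalGroup.toPath w).trans
          ((Path.Homotopic.Quotient.mk J.somePath).trans (Path.Homotopic.Quotient.mk h))
  -- identification of `β i`
  have hβ : ∀ i (hi : x₀ ∈ V i) (J : Joined x₀ (v i)) (h : Path (v i) x₀), range h ⊆ V i →
      β i = FundamentalGroup.fromPath ((Path.Homotopic.Quotient.mk J.somePath).trans
        (Path.Homotopic.Quotient.mk h)) := by
    intro i hi J h hh
    have e : Path.Homotopic.Quotient.mk (pth i (v i) (hv i) x₀ hi) =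
        Path.Homotopic.Quotient.mk h := by
      refine Path.Homotopic.Quotient.eq.2 (Literature.Topology.FourManifolds.Path.Homotopic.of_trans_symm ?_)
      apply hnull i i ⟨v i, hv i, hv i⟩
      rw [Path.trans_range, Path.symm_range, union_self]
      exact union_subset (hpth _ _ _ _ _) hh
    have hβi : β i = FundamentalGroup.fromPath (Path.Homotopic.Quotient.mk
        (J.somePath.trans (pth i (v i) (hv i) x₀ hi))) := dif_pos hi
    rw [hβi, Path.Homotopic.Quotient.mk_trans, e]
  -- base case
  have base : ∀ i, P 0 i := by
    intro i y hy hyi J h hh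
    obtain rfl : x₀ = y := γ.source.symm.trans hy
    refine ⟨(β i)⁻¹, H.inv_mem (hβH i), ?_⟩
    rw [e00, hβ i hyi J h hh, Path.Homotopic.Quotient.mk_refl, FundamentalGroup.inv_def]
    exact (Path.Homotopic.Quotient.symm_trans _).symm
  -- induction step
  have step : ∀ (s s' : I) (i j : ι), s ≤ s' → Icc s s' ⊆ γ ⁻¹' V i → P s i → P s' j := by
    intro s s' i j hss' hI hP y hy hyj J h hh
    subst hy
    have hpi : γ s' ∈ V i := hI ⟨hss', le_rfl⟩
    have hsi : γ s ∈ V i := hI ⟨le_rfl, hss'⟩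
    have hij : (V i ∩ V j).Nonempty := ⟨γ s', hpi, hyj⟩
    -- auxiliary paths inside `V i`, `V j`
    let h₁ : Path (v i) (γ s') := pth i (v i) (hv i) (γ s') hpi
    let h' : Path (v i) (γ s) := pth i (v i) (hv i) (γ s) hsi
    have hh' : range h' ⊆ V i := hpth _ _ _ _ _
    let seg : Path (γ s) (γ s') := γ.subpath s s'
    have hseg : range seg ⊆ V i := by
      rw [Path.range_subpath_of_le γ s s' hss']
      exact image_subset_iff.2 hI
    let a : Path (v i) (q (i, j)) := pth i (v i) (hv i) (q (i, j)) (hq (i, j) hij).1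
    let b : Path (q (i, j)) (v j) := pth j (q (i, j)) (hq (i, j) hij).2 (v j) (hv j)
    have Ji : Joined x₀ (v i) := ⟨((γ.subpath 0 s').cast hx rfl).trans h₁.symm⟩
    -- induction hypothesis for the prefix up to `s`
    obtain ⟨w₁, hw₁, E1⟩ := hP (γ s) rfl hsi Ji h' hh'
    -- the two paths from `v i` to `v j` inside `V i ∪ V j` are homotopic
    have E2 : Path.Homotopic.Quotient.mk ((h'.trans seg).trans h.symm) =
        Path.Homotopic.Quotient.mk (a.trans b) := by
      refine Path.Homotopic.Quotient.eq.2 (Literature.Topology.FourManifolds.Path.Homotopic.of_trans_symm ?_)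
      apply hnull i j hij
      simp only [Path.trans_range, Path.symm_range]
      refine union_subset (union_subset (union_subset (hh'.trans subset_union_left)
        (hseg.trans subset_union_left)) (hh.trans subset_union_right))
        (union_subset ((hpth _ _ _ _ _).trans subset_union_left)
          ((hpth _ _ _ _ _).trans subset_union_right))
    have E2' : (Path.Homotopic.Quotient.mk h').trans (Path.Homotopic.Quotient.mk seg) =
        (Path.Homotopic.Quotient.mk a).trans ((Path.Homotopic.Quotient.mk b).trans
          (Path.Homotopic.Quotient.mk h)) := by
      have := congrArg (fun z => z.trans (Path.Homotopic.Quotient.mk h)) E2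
      simpa only [Path.Homotopic.Quotient.mk_trans, Path.Homotopic.Quotient.mk_symm,
        Path.Homotopic.Quotient.trans_assoc, Path.Homotopic.Quotient.symm_trans,
        Path.Homotopic.Quotient.trans_refl] using this
    -- the generator `α (i, j)` unfolds
    have hc : (V (i, j).1 ∩ V (i, j).2).Nonempty ∧ Joined x₀ (v (i, j).1) ∧
        Joined x₀ (v (i, j).2) := ⟨hij, Ji, J⟩
    have hα : α (i, j) = FundamentalGroup.fromPath (Path.Homotopic.Quotient.mk
        ((Ji.somePath.trans (a.trans b)).trans J.somePath.symm)) := dif_pos hc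
    -- the prefix up to `s'` is the prefix up to `s` followed by the piece `seg`
    -- (Mathlib `Path.Homotopy.subpathTransSubpath`)
    have E3 : Path.Homotopic.Quotient.mk ((γ.subpath 0 s').cast hx rfl) =
        (Path.Homotopic.Quotient.mk ((γ.subpath 0 s).cast hx rfl)).trans
          (Path.Homotopic.Quotient.mk seg) := by
      rw [← Path.Homotopic.Quotient.mk_trans, Path.Homotopic.Quotient.eq]
      exact Path.Homotopic.pathCast
        (Path.Homotopic.symm ⟨Path.Homotopy.subpathTransSubpath γ 0 s s'⟩) hx rfl
    refine ⟨α (i, j) * w₁, H.mul_mem (hαH (i, j)) hw₁, ?_⟩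
    rw [E3, E1, FundamentalGroup.mul_def, hα]
    simp only [FundamentalGroup.toPath, FundamentalGroup.toArrow, FundamentalGroup.fromPath,
      FundamentalGroup.fromArrow, Path.Homotopic.Quotient.mk_trans, Path.Homotopic.Quotient.mk_symm,
      Path.Homotopic.Quotient.trans_assoc, E2', cancel]
  -- (6) induction along the partition and conclusion
  have hall : ∀ n, P (t n) (idx n) := by
    intro n
    induction n with
    | zero => rw [ht0]; exact base _
    | succ n ih =>
      exact step (t n) (t (n + 1)) (idx n) (idx (n + 1)) (htm n.le_succ) (hidx n) ih
  have hfin : P 1 (idx N) := by rw [← hN N le_rfl]; exact hall N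
  have h1i : x₀ ∈ V (idx N) := by
    have : γ (t N) ∈ V (idx N) := hidx N ⟨le_rfl, htm N.le_succ⟩
    rwa [hN N le_rfl, γ.target] at this
  let h : Path (v (idx N)) x₀ := pth (idx N) (v (idx N)) (hv (idx N)) x₀ h1i
  have hh : range h ⊆ V (idx N) := hpth _ _ _ _ _
  have J : Joined x₀ (v (idx N)) := ⟨h.symm⟩
  obtain ⟨w, hw, E⟩ := hfin x₀ γ.target h1i J h hh
  rw [e01] at E
  have hγ : FundamentalGroup.fromPath (Path.Homotopic.Quotient.mk γ) = β (idx N) * w := by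
    rw [FundamentalGroup.mul_def, hβ (idx N) h1i J h hh]
    exact E
  rw [hγ]
  exact H.mul_mem (hβH (idx N)) hw

/-- **Subspace form with simply connected containers.** Let `U ⊆ Y` be covered by finitely many
subsets `W i ⊆ U` of `Y`, each open in `Y` and path connected, such that whenever `W i ∩ W j ≠ ∅`
the union `W i ∪ W j` lies in a subset `R ⊆ U` which is simply connected (as a subspace of `Y`,
Mathlib's `IsSimplyConnected`; e.g. contractible: `show SimplyConnectedSpace R from inferInstance`).
Then the fundamental group of the subspace `U` is finitely generated at every base point. Note that
the hypotheses force `U = ⋃ i, W i` to be *open* in `Y`; the intended use is for open subsets such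
as knot complements. (Corollary of `fundamentalGroup_fg_of_finite_cover`: loops in a simply
connected subset are null-homotopic, `homotopic_refl_of_range_subset_preimage_val`.) [folklore] -/
theorem fundamentalGroup_fg_of_finite_cover_of_isSimplyConnected {Y : Type*} [TopologicalSpace Y]
    {U : Set Y} {ι : Type*} [Finite ι] (W : ι → Set Y) (hWo : ∀ i, IsOpen (W i))
    (hWU : ∀ i, W i ⊆ U) (hWc : ∀ i, IsPathConnected (W i)) (hcov : U ⊆ ⋃ i, W i)
    (hR : ∀ i j, (W i ∩ W j).Nonempty → ∃ R : Set Y, W i ∪ W j ⊆ R ∧ R ⊆ U ∧ IsSimplyConnected R)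
    (x₀ : U) : Group.FG (FundamentalGroup U x₀) := by
  refine fundamentalGroup_fg_of_finite_cover (fun i => ((↑) : U → Y) ⁻¹' W i)
    (fun i => (hWo i).preimage continuous_subtype_val) (fun i => (hWc i).preimage_coe (hWU i))
    ?_ ?_ x₀
  · ext x
    simp only [mem_iUnion, mem_preimage, mem_univ, iff_true]
    exact mem_iUnion.1 (hcov x.2)
  · rintro i j ⟨x, hxi, hxj⟩ y γ hγ
    obtain ⟨R, hWR, hRU, hRc⟩ := hR i j ⟨x, hxi, hxj⟩
    refine homotopic_refl_of_range_subset_preimage_val hRU hRc γ (hγ.trans ?_)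
    rw [← preimage_union]
    exact preimage_mono hWR

end Literature.AlgebraicTopology.FundamentalGroup
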